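import Literature.Barriers.Schanuel.AlgebraicIndependenceOfLogarithmsThm4FromThm2A
import HarnessLib

/-!
# Barrier (Schanuel): Roy 1992, Theorem 2 ⇒ Theorem 4 — the map `φ` of p. 35

Third support file for the deduction of Roy's Theorem 4 (`roy1992_thm4`) from his Theorem 2
(`roy1992_thm2`) [Roy1992, §4 pp. 34–37]. With a number field `k ⊂ ℂ` and a basis
`η₁, …, η_m` of `k` over `ℚ` (p. 35: "Let `η₁, …, η_m` be a basis of `k` over `ℚ`. Consider the
surjective `K`-linear mapping `φ : K^d × (K^d)^m → K^d`, `(x, (y₁, …, y_m)) ↦ x + η₁y₁ + ⋯ + η_my_m`.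
It gives by restriction a surjective `ℚ`-linear mapping from `k^d × (L^d)^m` to `(k + k·L)^d`. We
put … `W = φ⁻¹(0)`"), this file provides, on the space `LinTangent d (m·d) = K^d × K^{md}` of the
named facts `roy1992_thm1/thm2` (the factor `(K^d)^m` being flattened by `finProdFinEquiv`):

* `Roy1992.block μ`, `Roy1992.psi e` (`y ↦ ∑ e_μ y_μ`) over any commutative ring, and the change of
  level `Roy1992.incl_psi`; `Roy1992.psi_incl_eq_zero` — `ψ` is injective on `ℚ^{md}` when `e = η`
  is a `ℚ`-basis ("`φ` induces by restriction a `ℚ`-linear isomorphism from `0 × (ℚ^d)^m` to `k^d`",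
  p. 36).
* `Roy1992.phi η` — the map `φ`, `phi_apply`, `phi_surjective`, `finrank_ker_phi` (`= md`, used as
  "`d + md − dim_K(W) = d`", p. 37) and `isQbarRational_ker_phi` (`W = ker φ` is rational over
  `ℚ̄`, a hypothesis of Theorem 2).
* `Roy1992.exists_expansion` — every element of `k + k·L = span_k ({1} ∪ L)` is `x + ∑ η_μ y_μ` with
  `x ∈ k`, `y_μ ∈ 𝓛 = logQSpan` (the surjectivity of `φ : k^d × (L^d)^m → (k + k·L)^d`), and its
  vector form `Roy1992.exists_phi_preimage`.
* `Roy1992.linearIndependent_eta_smul` — for a `ℚ̄`-independent family `z_r` of `ℂ^d`, the family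
  `η_μ z_r` is `ℚ`-independent (the count "`dim_ℚ(Y) ≥ dim_ℚ(Z₁) = m dim_k(Z₁) ≥ m dim_ℚ̄(Z)`",
  p. 37).

Everything is proved; no new facts.

## References

* [Roy1992] D. Roy, *Matrices whose coefficients are linear forms in logarithms*, J. Number
  Theory 41 (1992) 22–47: §4, proof of Theorem 4, pp. 35–37.
-/

noncomputable section

open Module Submodule Complex

namespace Literature.Barriers.Schanuel.Roy1992

variable {d m : ℕ}

/-! ### The blocks `y_μ` and the map `ψ : y ↦ ∑ e_μ y_μ` -/

section Psi

variable (R : Type*) [CommRing R]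

/-- The `μ`-th block `y_μ ∈ R^d` of `y ∈ R^{md} = (R^d)^m` (`(y_μ)_i = y_{(μ, i)}` through
`finProdFinEquiv : Fin m × Fin d ≃ Fin (m·d)`). [cite: Roy1992, §4 proof of Theorem 4 (p. 35)] -/
def block (μ : Fin m) : (Fin (m * d) → R) →ₗ[R] (Fin d → R) :=
  LinearMap.funLeft R R fun i => finProdFinEquiv (μ, i)

variable {R}

/-- `(block μ y) i = y (μ, i)`. [folklore] -/
@[simp] theorem block_apply (μ : Fin m) (y : Fin (m * d) → R) (i : Fin d) :
    block R μ y i = y (finProdFinEquiv (μ, i)) := rfl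

/-- The map `ψ_e : y ↦ ∑_μ e_μ y_μ` (`R^{md} → R^d`) for elements `e_μ ∈ R`.
[cite: Roy1992, §4 proof of Theorem 4 (p. 35)] -/
def psi (e : Fin m → R) : (Fin (m * d) → R) →ₗ[R] (Fin d → R) :=
  ∑ μ, e μ • block R μ

/-- `(ψ_e y) i = ∑_μ e_μ y_{(μ,i)}`. [folklore] -/
theorem psi_apply (e : Fin m → R) (y : Fin (m * d) → R) (i : Fin d) :
    psi e y i = ∑ μ, e μ * y (finProdFinEquiv (μ, i)) := by
  simp [psi, LinearMap.sum_apply, Finset.sum_apply]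

/-- **Change of level**: for a ring map `F → K`, `incl (ψ_e y) = ψ_{e'} (incl y)` with
`e' = algebraMap ∘ e`. [folklore] -/
theorem incl_psi {F K : Type*} [Field F] [Field K] [Algebra F K] (e : Fin m → F)
    (y : Fin (m * d) → F) :
    incl F K d (psi e y) = psi (fun μ => algebraMap F K (e μ)) (incl F K (m * d) y) := by
  funext i
  simp [psi_apply, map_sum]

/-- `ψ_e y` has coordinates in a subfield containing the `e_μ` and the coordinates of `y`. [folklore] -/
theorem psi_mem (S : IntermediateField ℚ ℂ) {e : Fin m → ℂ} (he : ∀ μ, e μ ∈ S)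
    {y : Fin (m * d) → ℂ} (hy : ∀ j, y j ∈ S) (i : Fin d) : psi e y i ∈ S := by
  rw [psi_apply]
  exact sum_mem fun μ _ => mul_mem (he μ) (hy _)

end Psi

/-! ### `ψ_η` is injective on rational vectors -/

variable {k : IntermediateField ℚ ℂ} (η : Basis (Fin m) ℚ k)

/-- **`ψ_η` is injective on `ℚ^{md}`** ("`φ` induces by restriction a `ℚ`-linear isomorphism from
`0 × (ℚ^d)^m` to `k^d`"): if `∑_μ η_μ y_μ = 0` with rational `y_μ` then `y = 0`.
[cite: Roy1992, §4 proof of Theorem 4 (p. 36)] -/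
theorem psi_incl_eq_zero {y : Fin (m * d) → ℚ} (hy : psi (fun μ => (η μ : k)) (incl ℚ k (m * d) y) = 0) :
    y = 0 := by
  have hcoord : ∀ i : Fin d, ∀ μ : Fin m, y (finProdFinEquiv (μ, i)) = 0 := by
    intro i
    have hi := congrFun hy i
    rw [psi_apply, Pi.zero_apply] at hi
    have hi' : ∑ μ, y (finProdFinEquiv (μ, i)) • η μ = 0 := by
      rw [← hi]
      refine Finset.sum_congr rfl fun μ _ => ?_
      rw [incl_apply, Algebra.smul_def, mul_comm]
    exact Fintype.linearIndependent_iff.1 η.linearIndependent _ hi'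
  funext j
  obtain ⟨⟨μ, i⟩, rfl⟩ := finProdFinEquiv.surjective j
  exact hcoord i μ

/-! ### The map `φ` -/

/-- **Roy's map `φ : K^d × (K^d)^m → K^d`, `(x, y) ↦ x + ∑_μ η_μ y_μ`** (`K = ℂ`), on
`LinTangent d (m·d)`. [cite: Roy1992, §4 proof of Theorem 4 (p. 35)] -/
def phi : LinTangent d (m * d) →ₗ[ℂ] (Fin d → ℂ) :=
  LinearMap.fst ℂ _ _ + psi (fun μ => ((η μ : k) : ℂ)) ∘ₗ LinearMap.snd ℂ _ _

/-- `φ (x, y) = x + ψ_η y`. [cite: Roy1992, §4 proof of Theorem 4 (p. 35)] -/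
@[simp] theorem phi_apply (p : LinTangent d (m * d)) :
    phi η p = p.1 + psi (fun μ => ((η μ : k) : ℂ)) p.2 := rfl

/-- `φ` is surjective (`φ(x, 0) = x`). [cite: Roy1992, §4 proof of Theorem 4 (p. 35)] -/
theorem phi_surjective : Function.Surjective (phi (d := d) η) :=
  fun x => ⟨(x, 0), by simp⟩

/-- `dim_K ker φ = md` (so that `d + md − dim_K(W) = d` for `W = ker φ`).
[cite: Roy1992, §4 proof of Theorem 4 (p. 37)] -/
theorem finrank_ker_phi : finrank ℂ (LinearMap.ker (phi (d := d) η)) = m * d := by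
  have h := LinearMap.finrank_range_add_finrank_ker (phi (d := d) η)
  rw [LinearMap.range_eq_top.2 (phi_surjective η), finrank_top, finrank_fin_fun, Module.finrank_prod,
    finrank_fin_fun, finrank_fin_fun] at h
  omega

/-- The graph map `y ↦ (−ψ_η y, y)`, whose range is `ker φ`. [folklore] -/
def kerGraph : (Fin (m * d) → ℂ) →ₗ[ℂ] LinTangent d (m * d) :=
  LinearMap.prod (-(psi fun μ => ((η μ : k) : ℂ))) LinearMap.id

/-- `ker φ` is the range of the graph map. [folklore] -/
theorem ker_phi_eq_range : LinearMap.ker (phi (d := d) η) = LinearMap.range (kerGraph (d := d) η) := by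
  ext p
  constructor
  · intro hp
    rw [LinearMap.mem_ker, phi_apply] at hp
    have h1 : p.1 = -(psi (fun μ => ((η μ : k) : ℂ)) p.2) := eq_neg_of_add_eq_zero_left hp
    refine ⟨p.2, Prod.ext ?_ ?_⟩
    · rw [h1]; simp [kerGraph]
    · simp [kerGraph]
  · rintro ⟨y, rfl⟩
    rw [LinearMap.mem_ker, phi_apply]
    simp [kerGraph]

variable [FiniteDimensional ℚ k]

/-- The `η_μ` are algebraic. [folklore] -/
theorem eta_mem_algebraicClosure (μ : Fin m) : ((η μ : k) : ℂ) ∈ algebraicClosure ℚ ℂ :=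
  mem_algebraicClosure_of_mem_numberField (η μ).2

/-- **`W = ker φ` is rational over `ℚ̄`** (a hypothesis of Theorem 2 for the object
`(K^d × (K^d)^m, Y, W, V)` of p. 35): `ker φ` is spanned by the `ℚ̄`-points `(−η_μ e_i, e_{(μ,i)})`.
[cite: Roy1992, §4 proof of Theorem 4 (p. 35)] -/
theorem isQbarRational_ker_phi : IsQbarRational (LinearMap.ker (phi (d := d) η)) := by
  refine le_antisymm ?_ (Submodule.span_le.2 fun v hv => hv.1)
  rw [ker_phi_eq_range, LinearMap.range_eq_map, ← (Pi.basisFun ℂ (Fin (m * d))).span_eq,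
    Submodule.map_span]
  refine Submodule.span_mono ?_
  rintro _ ⟨_, ⟨j, rfl⟩, rfl⟩
  refine ⟨Submodule.subset_span ⟨_, ⟨j, rfl⟩, rfl⟩, ?_, ?_⟩
  · intro i
    simp only [kerGraph, LinearMap.prod_apply, Pi.basisFun_apply]
    refine neg_mem (psi_mem (algebraicClosure ℚ ℂ) (eta_mem_algebraicClosure η) (fun j' => ?_) i)
    by_cases h : j' = j
    · subst h; simp
    · simp [h]
  · intro j'
    simp only [kerGraph, LinearMap.prod_apply, LinearMap.id_coe, Pi.basisFun_apply]
    by_cases h : j' = j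
    · subst h; simp
    · simp [h]

/-! ### `k + k·L = φ(k^d × (L^d)^m)`: the expansion `x + ∑ η_μ y_μ` -/

omit [FiniteDimensional ℚ k] in
/-- Coordinates in the basis `η`, pushed to `ℂ`: `c = ∑_ν (η.repr c ν) · η_ν` in `ℂ`. [folklore] -/
theorem coe_eq_sum_repr (c : k) : (c : ℂ) = ∑ ν, ((η.repr c ν : ℚ) : ℂ) * ((η ν : k) : ℂ) := by
  conv_lhs => rw [← η.sum_repr c]
  rw [IntermediateField.coe_sum]
  refine Finset.sum_congr rfl fun ν _ => ?_
  rw [IntermediateField.coe_smul, Rat.smul_def]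

omit [FiniteDimensional ℚ k] in
/-- **The expansion lemma** (surjectivity of `φ : k^d × (L^d)^m → (k + k·L)^d`, coordinatewise):
every element of `k + k·L = span_k ({1} ∪ L)` can be written `x + ∑_μ η_μ y_μ` with `x ∈ k` and
`y_μ ∈ 𝓛 = logQSpan` (the `ℚ`-span of `L`). [cite: Roy1992, §4 proof of Theorem 4 (p. 35)] -/
theorem exists_expansion {c : ℂ}
    (hc : c ∈ Submodule.span k ({1} ∪ {x : ℂ | IsAlgebraic ℚ (cexp x)})) :
    ∃ (x : k) (y : Fin m → ℂ), (∀ μ, y μ ∈ logQSpan) ∧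
      c = x + ∑ μ, ((η μ : k) : ℂ) * y μ := by
  induction hc using Submodule.span_induction with
  | mem c hc =>
    rcases hc with hc | hc
    · rw [Set.mem_singleton_iff] at hc
      subst hc
      exact ⟨1, 0, fun _ => zero_mem _, by simp⟩
    · -- `ℓ = ∑_μ η_μ (q_μ ℓ)` with `1 = ∑ q_μ η_μ`
      refine ⟨0, fun μ => ((η.repr 1 μ : ℚ) : ℂ) * c, fun μ => ?_, ?_⟩
      · show ((η.repr 1 μ : ℚ) : ℂ) * c ∈ logQSpan
        rw [← Rat.smul_def]
        exact Submodule.smul_mem _ _ (Submodule.subset_span hc)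
      · have h1 := coe_eq_sum_repr η 1
        rw [IntermediateField.coe_one] at h1
        calc c = 1 * c := (one_mul c).symm
          _ = (∑ ν, ((η.repr 1 ν : ℚ) : ℂ) * ((η ν : k) : ℂ)) * c := by rw [← h1]
          _ = _ := by rw [IntermediateField.coe_zero, zero_add, Finset.sum_mul]
                      exact Finset.sum_congr rfl fun μ _ => by ring
  | zero => exact ⟨0, 0, fun _ => zero_mem _, by simp⟩
  | add c c' _ _ hc hc' =>
    obtain ⟨x, y, hy, rfl⟩ := hc
    obtain ⟨x', y', hy', rfl⟩ := hc'
    refine ⟨x + x', y + y', fun μ => add_mem (hy μ) (hy' μ), ?_⟩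
    rw [IntermediateField.coe_add]
    simp only [Pi.add_apply, mul_add, Finset.sum_add_distrib]
    ring
  | smul a c _ hc =>
    obtain ⟨x, y, hy, rfl⟩ := hc
    -- `a η_μ = ∑_ν r_{μν} η_ν`, so `∑_μ a η_μ y_μ = ∑_ν η_ν (∑_μ r_{μν} y_μ)`
    refine ⟨a * x, fun ν => ∑ μ, ((η.repr (a * η μ) ν : ℚ) : ℂ) * y μ, fun ν => ?_, ?_⟩
    · refine sum_mem fun μ _ => ?_
      rw [← Rat.smul_def]
      exact Submodule.smul_mem _ _ (hy μ)
    · rw [IntermediateField.smul_def, smul_eq_mul, IntermediateField.coe_mul, mul_add, Finset.mul_sum]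
      congr 1
      calc ∑ μ, (a : ℂ) * (((η μ : k) : ℂ) * y μ)
          = ∑ μ, ((a * η μ : k) : ℂ) * y μ := by
            refine Finset.sum_congr rfl fun μ _ => ?_
            rw [IntermediateField.coe_mul]; ring
        _ = ∑ μ, (∑ ν, ((η.repr (a * η μ) ν : ℚ) : ℂ) * ((η ν : k) : ℂ)) * y μ := by
            refine Finset.sum_congr rfl fun μ _ => ?_
            rw [← coe_eq_sum_repr η (a * η μ)]
        _ = ∑ ν, ((η ν : k) : ℂ) * ∑ μ, ((η.repr (a * η μ) ν : ℚ) : ℂ) * y μ := by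
            simp only [Finset.sum_mul, Finset.mul_sum]
            rw [Finset.sum_comm]
            refine Finset.sum_congr rfl fun ν _ => Finset.sum_congr rfl fun μ _ => ?_
            ring

omit [FiniteDimensional ℚ k] in
/-- **Preimages under `φ`**: a vector of `(k + k·L)^d` is `φ(p)` for some `p ∈ k^d × (L^d)^m`
(coordinatewise expansion). [cite: Roy1992, §4 proof of Theorem 4 (p. 35)] -/
theorem exists_phi_preimage {v : Fin d → ℂ}
    (hv : ∀ i, v i ∈ Submodule.span k ({1} ∪ {x : ℂ | IsAlgebraic ℚ (cexp x)})) :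
    ∃ p : LinTangent d (m * d), phi η p = v ∧ (∀ i, p.1 i ∈ k) ∧ ∀ j, p.2 j ∈ logQSpan := by
  choose x y hy hxy using fun i => exists_expansion η (hv i)
  refine ⟨(fun i => (x i : ℂ), fun j => y (finProdFinEquiv.symm j).2 (finProdFinEquiv.symm j).1),
    ?_, fun i => (x i).2, fun j => hy _ _⟩
  funext i
  rw [phi_apply, Pi.add_apply, psi_apply, hxy i]
  simp

/-! ### `ℚ`-independence of the `η_μ z_r` -/

/-- **The count `dim_ℚ Y ≥ m · dim_ℚ̄ Z`**: if `z₁, …, z_n ∈ ℂ^d` are `ℚ̄`-linearly independent then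
the `mn` vectors `η_μ z_r` are `ℚ`-linearly independent (a `ℚ`-relation `∑ q_{μr} η_μ z_r = 0` is a
`ℚ̄`-relation `∑_r (∑_μ q_{μr} η_μ) z_r = 0`, and `η` is a `ℚ`-basis of `k`).
[cite: Roy1992, §4 proof of Theorem 4 (p. 37)] -/
theorem linearIndependent_eta_smul {n : ℕ} {z : Fin n → (Fin d → ℂ)}
    (hz : LinearIndependent (algebraicClosure ℚ ℂ) z) :
    LinearIndependent ℚ (fun p : Fin m × Fin n => ((η p.1 : k) : ℂ) • z p.2) := by
  rw [Fintype.linearIndependent_iff]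
  intro g hg
  -- the `ℚ̄`-coefficients `c_r = ∑_μ g_{μ r} η_μ`
  have hcmem : ∀ r, ∑ μ, ((g (μ, r) : ℚ) : ℂ) * ((η μ : k) : ℂ) ∈ algebraicClosure ℚ ℂ := fun r =>
    sum_mem fun μ _ => mul_mem (by
      rw [mem_algebraicClosure_iff]
      exact isAlgebraic_algebraMap (g (μ, r))) (eta_mem_algebraicClosure η μ)
  let c : Fin n → algebraicClosure ℚ ℂ := fun r => ⟨_, hcmem r⟩
  have hrel : ∑ r, c r • z r = 0 := by
    rw [← hg, Fintype.sum_prod_type, Finset.sum_comm]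
    refine Finset.sum_congr rfl fun r _ => ?_
    funext i
    simp only [Pi.smul_apply, IntermediateField.smul_def, smul_eq_mul, Finset.sum_apply,
      Finset.sum_mul, c]
    refine Finset.sum_congr rfl fun μ _ => ?_
    try rw [Rat.smul_def]
    ring
  have hc0 : ∀ r, c r = 0 := Fintype.linearIndependent_iff.1 hz c hrel
  rintro ⟨μ, r⟩
  have hr : ∑ μ, g (μ, r) • η μ = 0 := by
    have h := congrArg (fun x : algebraicClosure ℚ ℂ => (x : ℂ)) (hc0 r)
    simp only [c, ZeroMemClass.coe_zero] at h
    apply Subtype.val_injective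
    rw [IntermediateField.coe_sum, ZeroMemClass.coe_zero, ← h]
    refine Finset.sum_congr rfl fun μ _ => ?_
    rw [IntermediateField.coe_smul, Rat.smul_def]
  exact Fintype.linearIndependent_iff.1 η.linearIndependent _ hr μ

end Literature.Barriers.Schanuel.Roy1992
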